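import Summits.Ventures.Crystal3D.Theorems.StickyWulffConstantGenericWallFloorRayAlignedDepth
import HarnessLib

/-!
# Separation is decided at shallow depth: the finite form of the `SeparatedWide` / `¬RayAligned` checks

HONEST FRAMING. Part of the venture `Summits/Ventures/Crystal3D` (cell `crystal3d-full`), helper `--supports` the
crux `GenericWallFloor` (stmt-Ventures-19480) of `route-Ventures-StickyWulffConstant`, registered line `WallLedgerG`,
open stub `stub_twoSlabAdhesion`; the kernel side of the SEP disjunct of the certificate `ResidualOneSidedCoverage`
(cf-p1 (lxiii), PREREG of 19480-p1).  The separated ledgers (`twoSlabAdhesion_stackLedger_local_sep_wide`, class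
`SeparatedWideAt`, `SeparatedTiltAtCharge`) require that NO frame of a `z₁`-stack of grain 1 over `(A₁, u₁, 0)` be
co-axial with ANY frame of a `z₂`-stack of grain 2 over `(A₂, u₂, 0)` — an infinite family of pairs.  By
`exists_shallow_witness` a co-axial pair of chain frames forces a co-axial pair at ray depths `d₁ + d₂ ≤ |κ|`, so it
suffices to check the finitely many shallow pairs:

* **`chainFrames_separated_of_shallow`** — if no pair (depth-`d₁` node of a `z₁`-ray of `(A₁, u₁)`, depth-`d₂` node of a
  `z₂`-ray of `(A₂, u₂)`) with `d₁ + d₂ ≤ |κ|` is co-axial, then no chain frames of the two grains are co-axial;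
* **`stackFrames_separated_of_shallow`** — hence no frames of sound well-formed stacks are (the hypothesis shape of the
  separated ledgers, via `frame_mem_chainFrames_of_stack`);
* `not_rayAlignedAt_of_shallow` — and the pair is not ray-aligned for that steep pair (`z₁ = e₃`, `z₂ = −e₃`).

WHAT THIS IS NOT: not the stub; no counting; F-C1 not moved.
-/

noncomputable section

namespace Summit.Ventures.Crystal3D.Theorems

open Summit.Ventures.Crystal3D Finset
open Literature.MathematicalPhysics.StatisticalMechanics (fccStacking barlowStacking IsHaggSeq)
open scoped InnerProductSpace

/-- **Separation of chain frames is decided at depth `|κ|`.** -/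
theorem chainFrames_separated_of_shallow {z₁ z₂ : EuclideanSpace ℝ (Fin 3)}
    {A₁ A₂ : EuclideanSpace ℝ (Fin 3) ≃ₗᵢ[ℝ] EuclideanSpace ℝ (Fin 3)} {u₁ u₂ : EuclideanSpace ℝ (Fin 3)}
    {κ : List (EuclideanSpace ℝ (Fin 3))}
    (hκl : ∀ μ ∈ κ, ‖μ‖ = 1 ∧
      ∀ w ∈ fccSlots, ⟪w, μ⟫_ℝ = 0 ∨ ⟪w, μ⟫_ℝ = Real.sqrt (2 / 3) ∨ ⟪w, μ⟫_ℝ = -Real.sqrt (2 / 3))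
    (hκc : List.IsChain (fun μ μ' => ⟪μ, μ'⟫_ℝ = 1 / 3 ∨ ⟪μ, μ'⟫_ℝ = -1 / 3) κ)
    (hA₂ : A₂ '' fccStacking 1 (Real.sqrt (2 / 3)) = (wordFrame A₁ κ) '' fccStacking 1 (Real.sqrt (2 / 3)))
    (hsep : ∀ d₁ d₂ : ℕ, d₁ + d₂ ≤ κ.length →
      ∀ G₁ G₂ : EuclideanSpace ℝ (Fin 3) ≃ₗᵢ[ℝ] EuclideanSpace ℝ (Fin 3),
      (d₁ = 0 ∧ G₁ = A₁ ∨ ∃ n₁ : EuclideanSpace ℝ (Fin 3), ‖n₁‖ = 1 ∧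
          (∀ w ∈ fccSlots, ⟪A₁ w, n₁⟫_ℝ = 0 ∨ ⟪A₁ w, n₁⟫_ℝ = Real.sqrt (2 / 3) ∨ ⟪A₁ w, n₁⟫_ℝ = -Real.sqrt (2 / 3)) ∧
          ⟪A₁ u₁, n₁⟫_ℝ = Real.sqrt (2 / 3) ∧ 0 < d₁ ∧ G₁ = (forcedTop z₁ ⟨A₁, u₁, 0⟩ n₁ (d₁ - 1)).frame) →
      (d₂ = 0 ∧ G₂ = A₂ ∨ ∃ n₂ : EuclideanSpace ℝ (Fin 3), ‖n₂‖ = 1 ∧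
          (∀ w ∈ fccSlots, ⟪A₂ w, n₂⟫_ℝ = 0 ∨ ⟪A₂ w, n₂⟫_ℝ = Real.sqrt (2 / 3) ∨ ⟪A₂ w, n₂⟫_ℝ = -Real.sqrt (2 / 3)) ∧
          ⟪A₂ u₂, n₂⟫_ℝ = Real.sqrt (2 / 3) ∧ 0 < d₂ ∧ G₂ = (forcedTop z₂ ⟨A₂, u₂, 0⟩ n₂ (d₂ - 1)).frame) →
      ¬ ∃ (L : EuclideanSpace ℝ (Fin 3) ≃ₗᵢ[ℝ] EuclideanSpace ℝ (Fin 3))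
          (s₁ s₂ : EuclideanSpace ℝ (Fin 3)) (σ σ' : ℤ → ℤ), IsHaggSeq σ ∧ IsHaggSeq σ' ∧
          G₁ '' fccStacking 1 (Real.sqrt (2 / 3)) ⊆ (fun p => L p + s₁) '' barlowStacking 1 (Real.sqrt (2 / 3)) σ ∧
          G₂ '' fccStacking 1 (Real.sqrt (2 / 3)) ⊆ (fun p => L p + s₂) '' barlowStacking 1 (Real.sqrt (2 / 3)) σ') :
    ∀ F₁ ∈ chainFrames z₁ A₁ u₁, ∀ F₂ ∈ chainFrames z₂ A₂ u₂,
      ¬ ∃ (L : EuclideanSpace ℝ (Fin 3) ≃ₗᵢ[ℝ] EuclideanSpace ℝ (Fin 3))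
          (s₁ s₂ : EuclideanSpace ℝ (Fin 3)) (σ σ' : ℤ → ℤ), IsHaggSeq σ ∧ IsHaggSeq σ' ∧
          F₁ '' fccStacking 1 (Real.sqrt (2 / 3)) ⊆ (fun p => L p + s₁) '' barlowStacking 1 (Real.sqrt (2 / 3)) σ ∧
          F₂ '' fccStacking 1 (Real.sqrt (2 / 3)) ⊆ (fun p => L p + s₂) '' barlowStacking 1 (Real.sqrt (2 / 3)) σ' := by
  intro F₁ hF₁ F₂ hF₂ hco
  obtain ⟨d₁, d₂, hle, -, G₁, -, G₂, -, hG₁, hG₂, hcoG⟩ := exists_shallow_witness hκl hκc hA₂ hF₁ hF₂ hco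
  exact hsep d₁ d₂ hle G₁ G₂ hG₁ hG₂ hcoG

/-- **Separation of STACK frames is decided at depth `|κ|`** — the hypothesis of the separated ledgers. -/
theorem stackFrames_separated_of_shallow {z₁ z₂ : EuclideanSpace ℝ (Fin 3)}
    {A₁ A₂ : EuclideanSpace ℝ (Fin 3) ≃ₗᵢ[ℝ] EuclideanSpace ℝ (Fin 3)} {u₁ u₂ : EuclideanSpace ℝ (Fin 3)}
    {κ : List (EuclideanSpace ℝ (Fin 3))}
    (hκl : ∀ μ ∈ κ, ‖μ‖ = 1 ∧
      ∀ w ∈ fccSlots, ⟪w, μ⟫_ℝ = 0 ∨ ⟪w, μ⟫_ℝ = Real.sqrt (2 / 3) ∨ ⟪w, μ⟫_ℝ = -Real.sqrt (2 / 3))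
    (hκc : List.IsChain (fun μ μ' => ⟪μ, μ'⟫_ℝ = 1 / 3 ∨ ⟪μ, μ'⟫_ℝ = -1 / 3) κ)
    (hA₂ : A₂ '' fccStacking 1 (Real.sqrt (2 / 3)) = (wordFrame A₁ κ) '' fccStacking 1 (Real.sqrt (2 / 3)))
    (hsep : ∀ d₁ d₂ : ℕ, d₁ + d₂ ≤ κ.length →
      ∀ G₁ G₂ : EuclideanSpace ℝ (Fin 3) ≃ₗᵢ[ℝ] EuclideanSpace ℝ (Fin 3),
      (d₁ = 0 ∧ G₁ = A₁ ∨ ∃ n₁ : EuclideanSpace ℝ (Fin 3), ‖n₁‖ = 1 ∧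
          (∀ w ∈ fccSlots, ⟪A₁ w, n₁⟫_ℝ = 0 ∨ ⟪A₁ w, n₁⟫_ℝ = Real.sqrt (2 / 3) ∨ ⟪A₁ w, n₁⟫_ℝ = -Real.sqrt (2 / 3)) ∧
          ⟪A₁ u₁, n₁⟫_ℝ = Real.sqrt (2 / 3) ∧ 0 < d₁ ∧ G₁ = (forcedTop z₁ ⟨A₁, u₁, 0⟩ n₁ (d₁ - 1)).frame) →
      (d₂ = 0 ∧ G₂ = A₂ ∨ ∃ n₂ : EuclideanSpace ℝ (Fin 3), ‖n₂‖ = 1 ∧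
          (∀ w ∈ fccSlots, ⟪A₂ w, n₂⟫_ℝ = 0 ∨ ⟪A₂ w, n₂⟫_ℝ = Real.sqrt (2 / 3) ∨ ⟪A₂ w, n₂⟫_ℝ = -Real.sqrt (2 / 3)) ∧
          ⟪A₂ u₂, n₂⟫_ℝ = Real.sqrt (2 / 3) ∧ 0 < d₂ ∧ G₂ = (forcedTop z₂ ⟨A₂, u₂, 0⟩ n₂ (d₂ - 1)).frame) →
      ¬ ∃ (L : EuclideanSpace ℝ (Fin 3) ≃ₗᵢ[ℝ] EuclideanSpace ℝ (Fin 3))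
          (s₁ s₂ : EuclideanSpace ℝ (Fin 3)) (σ σ' : ℤ → ℤ), IsHaggSeq σ ∧ IsHaggSeq σ' ∧
          G₁ '' fccStacking 1 (Real.sqrt (2 / 3)) ⊆ (fun p => L p + s₁) '' barlowStacking 1 (Real.sqrt (2 / 3)) σ ∧
          G₂ '' fccStacking 1 (Real.sqrt (2 / 3)) ⊆ (fun p => L p + s₂) '' barlowStacking 1 (Real.sqrt (2 / 3)) σ') :
    ∀ stk₁ : List WalkEntry, StackSound z₁ stk₁ → StackWF z₁ stk₁ → stk₁.getLast? = some ⟨A₁, u₁, 0⟩ →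
    ∀ e₁ ∈ stk₁,
    ∀ stk₂ : List WalkEntry, StackSound z₂ stk₂ → StackWF z₂ stk₂ → stk₂.getLast? = some ⟨A₂, u₂, 0⟩ →
    ∀ e₂ ∈ stk₂,
      ¬ ∃ (L : EuclideanSpace ℝ (Fin 3) ≃ₗᵢ[ℝ] EuclideanSpace ℝ (Fin 3)) (s₁ s₂ : EuclideanSpace ℝ (Fin 3))
          (σ σ' : ℤ → ℤ), IsHaggSeq σ ∧ IsHaggSeq σ' ∧
        e₁.frame '' fccStacking 1 (Real.sqrt (2 / 3)) ⊆
          (fun p => L p + s₁) '' barlowStacking 1 (Real.sqrt (2 / 3)) σ ∧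
        e₂.frame '' fccStacking 1 (Real.sqrt (2 / 3)) ⊆
          (fun p => L p + s₂) '' barlowStacking 1 (Real.sqrt (2 / 3)) σ' :=
  fun _ hS₁ hW₁ hl₁ e₁ he₁ _ hS₂ hW₂ hl₂ e₂ he₂ =>
    chainFrames_separated_of_shallow hκl hκc hA₂ hsep e₁.frame (frame_mem_chainFrames_of_stack hS₁ hW₁ hl₁ e₁ he₁)
      e₂.frame (frame_mem_chainFrames_of_stack hS₂ hW₂ hl₂ e₂ he₂)

/-- **Not ray-aligned from a shallow check**: one steep pair whose shallow node pairs are all non-co-axial. -/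
theorem not_rayAlignedAt_of_shallow {A₁ A₂ : EuclideanSpace ℝ (Fin 3) ≃ₗᵢ[ℝ] EuclideanSpace ℝ (Fin 3)}
    {u₁ u₂ : EuclideanSpace ℝ (Fin 3)} {κ : List (EuclideanSpace ℝ (Fin 3))}
    (hκl : ∀ μ ∈ κ, ‖μ‖ = 1 ∧
      ∀ w ∈ fccSlots, ⟪w, μ⟫_ℝ = 0 ∨ ⟪w, μ⟫_ℝ = Real.sqrt (2 / 3) ∨ ⟪w, μ⟫_ℝ = -Real.sqrt (2 / 3))
    (hκc : List.IsChain (fun μ μ' => ⟪μ, μ'⟫_ℝ = 1 / 3 ∨ ⟪μ, μ'⟫_ℝ = -1 / 3) κ)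
    (hA₂ : A₂ '' fccStacking 1 (Real.sqrt (2 / 3)) = (wordFrame A₁ κ) '' fccStacking 1 (Real.sqrt (2 / 3)))
    (hu₁ : u₁ ∈ fccSlots) (hs₁ : Real.sqrt 2 / 2 ≤ ⟪A₁ u₁, EuclideanSpace.single (2 : Fin 3) (1 : ℝ)⟫_ℝ)
    (hu₂ : u₂ ∈ fccSlots) (hs₂ : ⟪A₂ u₂, EuclideanSpace.single (2 : Fin 3) (1 : ℝ)⟫_ℝ ≤ -(Real.sqrt 2 / 2))
    (hsep : ∀ d₁ d₂ : ℕ, d₁ + d₂ ≤ κ.length →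
      ∀ G₁ G₂ : EuclideanSpace ℝ (Fin 3) ≃ₗᵢ[ℝ] EuclideanSpace ℝ (Fin 3),
      (d₁ = 0 ∧ G₁ = A₁ ∨ ∃ n₁ : EuclideanSpace ℝ (Fin 3), ‖n₁‖ = 1 ∧
          (∀ w ∈ fccSlots, ⟪A₁ w, n₁⟫_ℝ = 0 ∨ ⟪A₁ w, n₁⟫_ℝ = Real.sqrt (2 / 3) ∨ ⟪A₁ w, n₁⟫_ℝ = -Real.sqrt (2 / 3)) ∧
          ⟪A₁ u₁, n₁⟫_ℝ = Real.sqrt (2 / 3) ∧ 0 < d₁ ∧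
          G₁ = (forcedTop (EuclideanSpace.single (2 : Fin 3) (1 : ℝ)) ⟨A₁, u₁, 0⟩ n₁ (d₁ - 1)).frame) →
      (d₂ = 0 ∧ G₂ = A₂ ∨ ∃ n₂ : EuclideanSpace ℝ (Fin 3), ‖n₂‖ = 1 ∧
          (∀ w ∈ fccSlots, ⟪A₂ w, n₂⟫_ℝ = 0 ∨ ⟪A₂ w, n₂⟫_ℝ = Real.sqrt (2 / 3) ∨ ⟪A₂ w, n₂⟫_ℝ = -Real.sqrt (2 / 3)) ∧
          ⟪A₂ u₂, n₂⟫_ℝ = Real.sqrt (2 / 3) ∧ 0 < d₂ ∧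
          G₂ = (forcedTop (-EuclideanSpace.single (2 : Fin 3) (1 : ℝ)) ⟨A₂, u₂, 0⟩ n₂ (d₂ - 1)).frame) →
      ¬ ∃ (L : EuclideanSpace ℝ (Fin 3) ≃ₗᵢ[ℝ] EuclideanSpace ℝ (Fin 3))
          (s₁ s₂ : EuclideanSpace ℝ (Fin 3)) (σ σ' : ℤ → ℤ), IsHaggSeq σ ∧ IsHaggSeq σ' ∧
          G₁ '' fccStacking 1 (Real.sqrt (2 / 3)) ⊆ (fun p => L p + s₁) '' barlowStacking 1 (Real.sqrt (2 / 3)) σ ∧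
          G₂ '' fccStacking 1 (Real.sqrt (2 / 3)) ⊆ (fun p => L p + s₂) '' barlowStacking 1 (Real.sqrt (2 / 3)) σ') :
    ¬ RayAlignedAt A₁ A₂ := by
  intro hray
  obtain ⟨F₁, hF₁, F₂, hF₂, hco⟩ := hray u₁ hu₁ hs₁ u₂ hu₂ hs₂
  exact chainFrames_separated_of_shallow hκl hκc hA₂ hsep F₁ hF₁ F₂ hF₂ hco

end Summit.Ventures.Crystal3D.Theorems

end
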